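import Summits.QuantumFields.YangMills.Theorems.LuscherReductionTwistedTraceScalingCurvatureAction
import Summits.QuantumFields.YangMills.Theorems.LuscherReductionTwistedTraceScalingStiffHessian
import HarnessLib

/-!
# The COVARIANT linearised curl `D_U` and the exact transport identity `hol_p(W·U) = X_p(W;U) · hol_p(U)`
# (lane B of S-BASE, crux `TwistedTraceScaling` stmt-QuantumFields-20203; covariant reformulation of the Laplace step, blueprint §5, brick c1 part i)

A kinetic step multiplies every link on the left, `V = W·U` (`latE(U, W·U) = latE(1, W)`: the electric factor sees only `W`; Haar is invariant).
EXACTLY: `hol_p(W·U) = X_p · hol_p(U)` with `X_p = W₁ · Ad_{P₁}(W₂) · (Ad_{P₂}(W₃))⁻¹ · (Ad_{P₃}(W₄))⁻¹`, where `P₁ = U₁`, `P₂ = U₁U₂U₃⁻¹`,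
`P₃ = hol_p(U)` are the partial holonomies (parallel transports to the base point) and `Ad_P(W) = PWP⁻¹` (`hol_mul_eq_transportStep_mul`).  Since
`vecPart(PWP⁻¹) = adRot(P)·vecPart(W)` and `vecPart(W⁻¹) = −vecPart(W)` exactly, the vector parts of the four factors of `X_p` are the four terms of the
**covariant curl** `(D_U w)_p = w₁ + adRot(P₁)w₂ − adRot(P₂)w₃ − adRot(P₃)w₄` (`covCurl U : LinkSpace L →ₗ PlaqSpace L`), and `D_1 = latCurl`
(`covCurl_one`).  Part ii (successor): `F_p(W·U) = F_p(U) + (D_U w)_p + O(|w|_p² + |F_p(U)|·|w|_p)` from `vecPart_mul`/`scalarPart_mul`.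
HONEST FRAMING: group algebra; femto rung R2b1 (stub of a child of a CONDITIONAL route); not a gap, not Clay.
-/

set_option autoImplicit false

noncomputable section

open scoped Matrix BigOperators
open Literature.MathematicalPhysics.QuantumFieldTheory
open Literature.MathematicalPhysics.QuantumLattice

namespace Summit.QuantumFields.YangMills.Theorems.FemtoTransferGap.TwoLattice.Cov

open Summit.QuantumFields.YangMills.Theorems.FemtoTransferGap
open Summit.QuantumFields.YangMills.Theorems.FemtoTransferGap.TwoLattice
open Summit.QuantumFields.YangMills.Theorems.FemtoTransferGap.TwoLattice.Stiff
open Summit.QuantumFields.YangMills.Theorems.FemtoTransferGap.TwoLattice.Magnetic (su2_coe_inv)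

variable {L : ℕ} [NeZero L]

/-! ## §1 Quaternion parts of inverses; `adRot 1 = 1` -/

/-- `u₀(W⁻¹) = u₀(W)`. [folklore] -/
theorem scalarPart_inv (W : SU2) : scalarPart W⁻¹ = scalarPart W := by
  rw [scalarPart_eq, scalarPart_eq, su2_coe_inv, Matrix.conjTranspose_apply, Complex.star_def, Complex.conj_re]

/-- `vecPart(W⁻¹) = −vecPart(W)`. [folklore] -/
theorem vecPart_inv (W : SU2) : vecPart W⁻¹ = -vecPart W := by
  funext a
  fin_cases a
  · simp only [Fin.zero_eta, vecPart_zero, Pi.neg_apply]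
    rw [su2_coe_inv, Matrix.conjTranspose_apply, Complex.star_def, Complex.conj_im]
  · simp only [Fin.mk_one, vecPart_one, Pi.neg_apply]
    rw [su2_coe_inv, Matrix.conjTranspose_apply, Complex.star_def, su2_apply_10, map_neg, Complex.conj_conj, Complex.neg_re]
  · simp only [Fin.reduceFinMk, vecPart_two, Pi.neg_apply]
    rw [su2_coe_inv, Matrix.conjTranspose_apply, Complex.star_def, su2_apply_10, map_neg, Complex.conj_conj, Complex.neg_im]

/-- `adRot 1 = 1`. [folklore] -/
theorem adRot_one : adRot (1 : SU2) = 1 := by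
  have h00 : (((1 : SU2) : Matrix (Fin 2) (Fin 2) ℂ) 0 0) = 1 := by simp
  have h01 : (((1 : SU2) : Matrix (Fin 2) (Fin 2) ℂ) 0 1) = 0 := by simp
  unfold adRot
  simp only [h00, h01, Complex.one_re, Complex.one_im, Complex.zero_re, Complex.zero_im]
  ext i j
  fin_cases i <;> fin_cases j <;> norm_num

/-! ## §2 Partial holonomies and the exact transport identity -/

/-- First partial holonomy `P₁ = U(x,i)`. [folklore] -/
def ptrans1 (U : GaugeConfig 3 L SU2) (p : Plaquette 3 L) : SU2 := U (p.1, p.2.1.1)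

/-- Second partial holonomy `P₂ = U(x,i) U(x+eᵢ,j) U(x+eⱼ,i)⁻¹`. [folklore] -/
def ptrans2 (U : GaugeConfig 3 L SU2) (p : Plaquette 3 L) : SU2 :=
  U (p.1, p.2.1.1) * U (p.1.shift p.2.1.1, p.2.1.2) * (U (p.1.shift p.2.1.2, p.2.1.1))⁻¹

/-- **The transported step** `X_p(W;U) = W₁ · (P₁W₂P₁⁻¹) · (P₂W₃P₂⁻¹)⁻¹ · (P₃W₄P₃⁻¹)⁻¹`, `P₃ = hol_p(U)`. [cite: Luscher1983, §3] -/
def transportStep (W U : GaugeConfig 3 L SU2) (p : Plaquette 3 L) : SU2 :=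
  W (p.1, p.2.1.1) * (ptrans1 U p * W (p.1.shift p.2.1.1, p.2.1.2) * (ptrans1 U p)⁻¹) *
    (ptrans2 U p * W (p.1.shift p.2.1.2, p.2.1.1) * (ptrans2 U p)⁻¹)⁻¹ * (hol U p * W (p.1, p.2.1.2) * (hol U p)⁻¹)⁻¹

omit [NeZero L] in
/-- ★ **EXACT TRANSPORT IDENTITY** `hol_p(W·U) = X_p(W;U) · hol_p(U)`. [cite: Luscher1983, §3] -/
theorem hol_mul_eq_transportStep_mul (W U : GaugeConfig 3 L SU2) (p : Plaquette 3 L) :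
    hol (W * U) p = transportStep W U p * hol U p := by
  simp only [hol, transportStep, ptrans1, ptrans2, plaquetteHolonomy, Pi.mul_apply]
  group

omit [NeZero L] in
/-- At `U = 1` the transported step is the plain plaquette word of `W`: `X_p(W;1) = hol_p(W)`. [folklore] -/
theorem transportStep_one (W : GaugeConfig 3 L SU2) (p : Plaquette 3 L) : transportStep W 1 p = hol W p := by
  simp only [hol, transportStep, ptrans1, ptrans2, plaquetteHolonomy, Pi.one_apply]
  group

omit [NeZero L] in
/-- The vector parts of the four factors of `X_p`: `vecPart(P W P⁻¹) = adRot(P)·vecPart(W)`, `vecPart((P W P⁻¹)⁻¹) = −adRot(P)·vecPart(W)`. [folklore] -/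
theorem vecPart_conj_inv (P W : SU2) : vecPart (P * W * P⁻¹)⁻¹ = -((adRot P).mulVec (vecPart W)) := by
  rw [vecPart_inv, vecPart_conj]

/-! ## §3 The covariant curl -/

/-- The covariant curl on raw functions: `(D_U w)(p,a) = w(e₁,a) + (adRot P₁ w(e₂,·))_a − (adRot P₂ w(e₃,·))_a − (adRot P₃ w(e₄,·))_a`.
[cite: Luscher1983, §3] -/
def covCurlFun (U : GaugeConfig 3 L SU2) : (Edge 3 L × Fin 3 → ℝ) →ₗ[ℝ] (Plaquette 3 L × Fin 3 → ℝ) where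
  toFun w q := w ((q.1.1, q.1.2.1.1), q.2)
    + ∑ b, adRot (ptrans1 U q.1) q.2 b * w ((q.1.1.shift q.1.2.1.1, q.1.2.1.2), b)
    - ∑ b, adRot (ptrans2 U q.1) q.2 b * w ((q.1.1.shift q.1.2.1.2, q.1.2.1.1), b)
    - ∑ b, adRot (hol U q.1) q.2 b * w ((q.1.1, q.1.2.1.2), b)
  map_add' v w := by
    funext q
    simp only [Pi.add_apply, mul_add, Finset.sum_add_distrib]
    ring
  map_smul' r v := by
    funext q
    simp only [Pi.smul_apply, smul_eq_mul, RingHom.id_apply, mul_add, mul_sub, Finset.mul_sum]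
    have h : ∀ (A : Matrix (Fin 3) (Fin 3) ℝ) (f : Fin 3 → ℝ), ∑ b, A q.2 b * (r * f b) = ∑ b, r * (A q.2 b * f b) :=
      fun A f => Finset.sum_congr rfl fun b _ => by ring
    rw [h, h, h]

/-- **The covariant linearised curl** `D_U : LinkSpace L → PlaqSpace L`. [cite: Luscher1983, §3] -/
def covCurl (U : GaugeConfig 3 L SU2) : LinkSpace L →ₗ[ℝ] PlaqSpace L :=
  (WithLp.linearEquiv 2 ℝ (Plaquette 3 L × Fin 3 → ℝ)).symm.toLinearMap ∘ₗ covCurlFun U ∘ₗ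
    (WithLp.linearEquiv 2 ℝ (Edge 3 L × Fin 3 → ℝ)).toLinearMap

omit [NeZero L] in
/-- Components of the covariant curl. [cite: Luscher1983, §3] -/
theorem covCurl_apply (U : GaugeConfig 3 L SU2) (w : LinkSpace L) (x : Site 3 L) (ij : {q : Fin 3 × Fin 3 // q.1 < q.2}) (a : Fin 3) :
    covCurl U w ((x, ij), a) =
      w ((x, ij.1.1), a) + ∑ b, adRot (ptrans1 U (x, ij)) a b * w ((x.shift ij.1.1, ij.1.2), b)
        - ∑ b, adRot (ptrans2 U (x, ij)) a b * w ((x.shift ij.1.2, ij.1.1), b)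
        - ∑ b, adRot (hol U (x, ij)) a b * w ((x, ij.1.2), b) := by
  simp [covCurl, covCurlFun]

omit [NeZero L] in
/-- ★ At the vacuum the covariant curl is the lattice curl: `D_1 = d`. [cite: Luscher1983, §3] -/
theorem covCurl_one : covCurl (1 : GaugeConfig 3 L SU2) = latCurl L := by
  apply LinearMap.ext; intro w
  ext ⟨⟨x, ij⟩, a⟩
  have h1 : ptrans1 (1 : GaugeConfig 3 L SU2) (x, ij) = 1 := rfl
  have h2 : ptrans2 (1 : GaugeConfig 3 L SU2) (x, ij) = 1 := by simp [ptrans2]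
  have h3 : hol (1 : GaugeConfig 3 L SU2) (x, ij) = 1 := by simp [hol, plaquetteHolonomy]
  rw [covCurl_apply, latCurl_apply, h1, h2, h3, adRot_one]
  simp only [Matrix.one_apply, ite_mul, one_mul, zero_mul, Finset.sum_ite_eq, Finset.mem_univ, if_true]

omit [NeZero L] in
/-- ★ **The linear part of the transported step is the covariant curl**: the sum of the vector parts of the four factors of `X_p(W;U)` is
`(D_U w)_p` with `w = vecPart ∘ W` (colour by colour). [cite: Luscher1983, §3] -/
theorem sum_vecPart_factors_eq_covCurl (W U : GaugeConfig 3 L SU2) (p : Plaquette 3 L) (a : Fin 3) :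
    vecPart (W (p.1, p.2.1.1)) a + vecPart (ptrans1 U p * W (p.1.shift p.2.1.1, p.2.1.2) * (ptrans1 U p)⁻¹) a
        + vecPart (ptrans2 U p * W (p.1.shift p.2.1.2, p.2.1.1) * (ptrans2 U p)⁻¹)⁻¹ a
        + vecPart (hol U p * W (p.1, p.2.1.2) * (hol U p)⁻¹)⁻¹ a =
      covCurl U (linkVec L W) (p, a) := by
  obtain ⟨x, ij⟩ := p
  rw [covCurl_apply, vecPart_conj, vecPart_conj_inv, vecPart_conj_inv]
  simp only [Pi.neg_apply, linkVec_apply, Matrix.mulVec, dotProduct]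
  ring

end Summit.QuantumFields.YangMills.Theorems.FemtoTransferGap.TwoLattice.Cov

end
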